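import Summits.QuantumFields.YangMills.Theorems.BalabanUVNodesN15TwoGridCellMean
import Summits.QuantumFields.YangMills.Theorems.BalabanUVNodesN15KingModelFullPropagatorMixedOperator
import Summits.QuantumFields.YangMills.Theorems.BalabanUVNodesN15KingModelFullPropagatorGradProfile
import Summits.QuantumFields.YangMills.Theorems.BalabanUVNodesN15KingModelFullPropagatorBgLetters
import Summits.QuantumFields.YangMills.Theorems.BalabanUVNodesN15VectorPieceBackgroundMatrix
import Literature.MathematicalPhysics.QuantumFieldTheory.Balaban1983to89.B6BondEliminationTorus
import HarnessLib

/-!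
# N15 (NE2), King-model rung — THE CELL-OSCILLATION ROW OF THE KING GRADIENT, part 1∕3 (KERNEL): cell geometry of King's pairing, the gradient
# `(N′∇′_ν ⊗ 1)(A₀′⁻¹ ⊗ 1)` and its composition with `N′(s_κ⁻¹ − 1)` as kernel sums, the level arithmetic, and cell-constant cut-offs of a line-mean-zero multiplier

WHY.  dag-n15-a's III-B (`…N15TwoGridDressedJetNoFitC`, p657735) closes the η-defect of the WHOLE first-order dressed jet `(X, ∇_μX)` of [B9] (3.62)–(3.65) from the bare
rows and ONE new input `hDGc`: the row of `(∇′_νG′) ∘ 𝔇(M_{c′}, M_{blockAvg c′})` — the sandwiched zeroth-order coefficient defect behind the GRADIENT.  Through M-A∕M-C's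
divergence device that row would need the unit-block row of the MIXED operator `∇′G′∇′*`, whose constant `log N′ = (m+k)·log L` is NOT uniform in the refinement `m`
(dag-n15-d I.41934 ∕ dag-n15-a I.42030).  Parts 1–3 produce `hDGc` for King's full `A = 0` propagator in the KERNEL currency instead, uniformly in `m`, with the constant
`C·r·(k+2)·L^{−k}` (III-A's numbers `θ = L⁻¹`, `k₀ = k + 1`): NEAR cells by the (1,0) profile, FAR cells by M-A's exact divergence form + the (1,1) profile with block decay.
WHAT (this part).  §1 `abs_sub_le_of_div_eq`, ★ `tdistT_le_of_kingPr_eq` (a cell of King's pairing `kingPr` has fine diameter `≤ L^m − 1`), `tdistT_blockOf_le_one_of_lt`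
(fine points closer than `N′` sit in adjacent unit blocks); §2 `sum_kernel_mul_adjDiff` (summation by parts), ★ `kingGrad_apply_eq_sum` (`(N′∇′_ν ⊗ 1)(A₀′⁻¹ ⊗ 1)` as the
kernel sum of `N′^{−(d+1)}·N′∂_νG′`), ★ `kingGrad_divAdj_apply_eq_sum` (composed with `N′(s_κ⁻¹ − 1)`: the kernel `N′^{−(d+1)}·DD_{νκ}G′` of n15-e part V-a); §3
`levelFar_sum_le` (`Σ_{i<K′} e^{−cL^i∕L^k} ≤ (k+1) + (1 − e^{−c})⁻¹` — the COARSE logarithm), `geom_le_two_mul_pow`, `fineLevels_sum_le`; §6 `lineMean_cellCut_eq_zero`,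
`linePrim_cellCut_eq_zero`, `abs_cellCut_le` (cut-offs by a cell-constant predicate keep zero `κ`-line means and the cell-locality of the line antiderivative),
`far_cellConst`, `tdistT_lt_of_not_far` (near cells lie in the fine ball of radius `2L^m`).  Over n15-a's `…TwoGridCellMean`∕`…TwoGridCellLines` (M-A∕M-C vocabulary:
`kingPrV`, `lineMean`, `linePrim`, `symbOp`, `sD`, `sTinv`), n15-e's Σ-a `kingGOp` and `…OperatorPrinted.inv_mulVec_eq_sum`, M4 `tensorId` BY NAME; nothing in the tree is modified.
HONEST FRAMING ∕ LIMITS.  Count-neutral kernel ∕ lattice bookkeeping on King's `A = 0` MODEL (template literature — C. King's scalar U(1)-Higgs model on finite tori,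
[King1986] (2.13)–(2.17) p. 653, Prop. 3.7 (3.63) p. 663, (4.42)–(4.44) p. 675), NOT Bałaban's covariant `G(U)`; [Balaban1985BackgroundPropagators] (3.35) p. 396, (3.52) p. 400,
(3.62)–(3.65) p. 402 are cited as the MECHANISM of the first-order dressed pair only.  NE2⁺ is NOT PRINTED and NOT proved here; N15 is NOT discharged; K3⁸
OPEN 0∕2; counts of record UNMOVED (typed 28∕28 · discharged 5∕27 · A 5∕28); one finite torus at fixed spacings per index — NOT ℝ⁴ ∕ infinite volume ∕ OS ∕ mass gap ∕ Clay.
0 `sorry`, 0 `def`, standard axioms.  Cell `pub-ymgap`, seat `pub-ymgap-dag-n15-d` (R134 N15 NE2 s3, King-model rung), generation 20; `--kind proof --supports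
stmt-QuantumFields-27366 --as helper` (K3⁸).  Consumer: dag-n15-a programme M-III, III-B `hasMaj_idef_bgPair_of_sandwichRows` hypothesis `hDGc` («ROW (go)» INBOX l.≈42090).
-/

noncomputable section

open scoped BigOperators
open Finset

namespace Summit.QuantumFields.YangMills.BalabanUVNodes.N15.KingModel.CellOsc

open Literature.MathematicalPhysics.QuantumFieldTheory.Balaban1983to89
open Literature.MathematicalPhysics.QuantumFieldTheory.Balaban1983to89.B11SectG (BlockNorm HasMaj hasMaj_sum)
open Literature.MathematicalPhysics.QuantumFieldTheory.Balaban1983to89.B11AxialTransport190 (abs_le_loc_ofBlocks loc_ofBlocks_le)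
open Literature.MathematicalPhysics.QuantumFieldTheory.Balaban1983to89.T4EtaRateDefect (idef idef_apply)
open Literature.MathematicalPhysics.QuantumFieldTheory.Balaban1983to89.T4EtaRateCoeffDefect (pull pull_apply blockAvg idef_mulOp_eq)
open Literature.MathematicalPhysics.QuantumFieldTheory.Balaban1983to89.B6Prop26Gluing (mulOp mulOp_apply)
open Literature.MathematicalPhysics.QuantumFieldTheory.Balaban1983to89.B5Prop11Plancherel (Tor fine unitVec)
open Literature.MathematicalPhysics.QuantumFieldTheory.Balaban1983to89.B4TorusKernel.MultiPeriod (circAbs circAbs_le_abs)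
open Literature.MathematicalPhysics.QuantumFieldTheory.Balaban1983to89.B4Sect5Torus (tdist)
open Literature.MathematicalPhysics.QuantumFieldTheory.Balaban1983to89.B6BondEliminationTorus (tdist_le_of_forall)
open Literature.MathematicalPhysics.QuantumFieldTheory.Balaban1983to89.B6UnitTorusCarrier (unitTorusGeo)
open Literature.MathematicalPhysics.QuantumFieldTheory.King1986 (aK aK_pos)
open Literature.MathematicalPhysics.QuantumFieldTheory.King1986.Torus (fineOp constrainedProp blockOf tdistT tdistT_nonneg tdistT_symm tdistT_self
  tdistT_triangle toSite one_le_period)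
open Summit.QuantumFields.YangMills.BalabanUVNodes.N15.VectorPiece (kingPr kingPrV kingPr_val kingPrV_eq blkFine blkFine_comp_kingPrV tensorId tensorId_apply)
open Summit.QuantumFields.YangMills.BalabanUVNodes.N15.TwoGrid
open Summit.QuantumFields.YangMills.BalabanUVNodes.N15KingModelRung.Curved

variable {d : ℕ} (L : ℕ) [NeZero L] (M : Fin (d + 1) → ℕ) [∀ μ, NeZero (M μ)] (k m : ℕ)

/-! ## §1 Cell geometry: a cell of King's pairing has fine diameter `≤ L^m − 1`; fine points closer than `N′` lie in adjacent unit blocks -/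

omit [NeZero L] [∀ μ, NeZero (M μ)] in
/-- natural numbers with the same quotient by `n > 0` differ by at most `n − 1`. [folklore] -/
theorem abs_sub_le_of_div_eq {a b n : ℕ} (hn : 0 < n) (h : a / n = b / n) : |((a : ℤ) - b)| ≤ (n : ℤ) - 1 := by
  have h1 : a < b + n := by
    have h2 : a < n * (a / n + 1) := Nat.lt_mul_div_succ a hn
    have h3 : n * (b / n) ≤ b := Nat.mul_div_le b n
    rw [h, Nat.mul_add, mul_one] at h2
    omega
  have h1' : b < a + n := by
    have h2 : b < n * (b / n + 1) := Nat.lt_mul_div_succ b hn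
    have h3 : n * (a / n) ≤ a := Nat.mul_div_le a n
    rw [← h, Nat.mul_add, mul_one] at h2
    omega
  rw [abs_le]
  constructor <;> omega

/-- ★ **THE CELL DIAMETER**: two fine points with the same King pairing point are within fine torus distance `L^m − 1` (the sup-circular distance,
coordinate by coordinate `|x′_μ − x″_μ| ≤ L^m − 1` since `⌊x′_μ∕L^m⌋ = ⌊x″_μ∕L^m⌋`). [cite: King1986, p.664 (the pairing «x′ ∈ B^n(x)»)] -/
theorem tdistT_le_of_kingPr_eq {x x' : Tor (fine (L ^ m * L ^ k) M)} (h : kingPr L k m M x = kingPr L k m M x') :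
    tdistT (fine (L ^ m * L ^ k) M) x x' ≤ ((L ^ m : ℕ) : ℝ) - 1 := by
  have hLm : 0 < L ^ m := pow_pos (Nat.pos_of_ne_zero (NeZero.ne L)) m
  have hr : (0 : ℝ) ≤ ((L ^ m : ℕ) : ℝ) - 1 := by
    have : (1 : ℝ) ≤ ((L ^ m : ℕ) : ℝ) := by exact_mod_cast hLm
    linarith
  unfold tdistT
  refine tdist_le_of_forall (one_le_period (fine (L ^ m * L ^ k) M)) _ _ hr fun μ => ?_
  have hq : (x μ).val / L ^ m = (x' μ).val / L ^ m := by
    have := congrArg (fun z : Tor (fine (L ^ k) M) => (z μ).val) h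
    simpa only [kingPr_val] using this
  have hz : |(((x μ).val : ℤ) - ((x' μ).val : ℤ))| ≤ ((L ^ m : ℕ) : ℤ) - 1 := abs_sub_le_of_div_eq hLm hq
  have hc : circAbs (fine (L ^ m * L ^ k) M μ) (((x μ).val : ℤ) - ((x' μ).val : ℤ)) ≤ ((L ^ m : ℕ) : ℤ) - 1 :=
    (circAbs_le_abs (one_le_period (fine (L ^ m * L ^ k) M) μ) _).trans hz
  have hc' : ((circAbs (fine (L ^ m * L ^ k) M μ) (((x μ).val : ℤ) - ((x' μ).val : ℤ)) : ℤ) : ℝ) ≤ (((L ^ m : ℕ) : ℤ) : ℝ) - 1 := by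
    exact_mod_cast hc
  simpa [toSite] using hc'

omit [NeZero L] in
/-- **fine points closer than one unit block lie in the same or in adjacent unit blocks**: `|x − x′| < n ⟹ |B(x) − B(x′)|_M ≤ 1`
(`n·|B(x) − B(x′)| ≤ |x − x′| + (n − 1)` and block distances are integers). [folklore] -/
theorem tdistT_blockOf_le_one_of_lt (n : ℕ) [NeZero n] {x x' : Tor (fine n M)} (h : tdistT (fine n M) x x' < n) :
    tdistT M (blockOf n M x) (blockOf n M x') ≤ 1 := by
  have hn0 : (0 : ℝ) < n := Nat.cast_pos.mpr (Nat.pos_of_ne_zero (NeZero.ne n))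
  have hmul := mul_tdistT_blockOf_le n M x x'
  obtain ⟨D, hD⟩ := exists_natCast_eq_tdistT M (blockOf n M x) (blockOf n M x')
  rw [hD] at hmul ⊢
  have hlt : (n : ℝ) * D < 2 * n := by linarith
  have hD2 : (D : ℝ) < 2 := by
    by_contra hcon
    push Not at hcon
    have : 2 * (n : ℝ) ≤ n * D := by nlinarith
    linarith
  have hD1 : D ≤ 1 := by
    have : (D : ℝ) < ((2 : ℕ) : ℝ) := by exact_mod_cast hD2
    have := (Nat.cast_lt (α := ℝ)).mp this
    omega
  exact_mod_cast hD1

/-! ## §2 The two kernel sums: `N′∇′_ν(A₀′⁻¹ ⊗ 1)` and its composition with the scaled adjoint difference `N′(s_κ⁻¹ − 1)` -/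

omit [NeZero L] [∀ μ, NeZero (M μ)] in
/-- summation by parts on a finite additive group: `Σ_y c·t(y)·(n(ψ(y − e) − ψ(y))) = Σ_y c·(n(t(y + e) − t(y)))·ψ(y)`. [folklore] -/
theorem sum_kernel_mul_adjDiff {X : Type} [Fintype X] [AddCommGroup X] (t ψ : X → ℝ) (e : X) (c n : ℝ) :
    ∑ y, c * t y * (n * (ψ (y - e) - ψ y)) = ∑ y, c * (n * (t (y + e) - t y)) * ψ y := by
  have hre : ∑ y, c * t y * (n * ψ (y - e)) = ∑ y, c * t (y + e) * (n * ψ y) := by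
    rw [← Equiv.sum_comp (Equiv.addRight e) (fun y => c * t y * (n * ψ (y - e)))]
    refine Finset.sum_congr rfl fun y _ => ?_
    simp only [Equiv.coe_addRight, add_sub_cancel_right]
  have h1 : ∑ y, c * t y * (n * (ψ (y - e) - ψ y)) = ∑ y, c * t y * (n * ψ (y - e)) - ∑ y, c * t y * (n * ψ y) := by
    rw [← Finset.sum_sub_distrib]
    exact Finset.sum_congr rfl fun y _ => by ring
  rw [h1, hre, ← Finset.sum_sub_distrib]
  exact Finset.sum_congr rfl fun y _ => by ring

section Kernel

variable (a msq : ℝ)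

/-- **THE GRADIENT AS A KERNEL SUM**: `((N′∇′_ν ⊗ 1)(A₀′⁻¹ ⊗ 1)ψ)(x, i) = Σ_y N′^{−(d+1)}·[N′(G′(x + e_ν, y) − G′(x, y))]·ψ(y, i)` with `G′ = N′^{d+1}A₀′⁻¹`
(`constrainedProp`). [cite: King1986, (2.13) p.653, (4.44) p.675] -/
theorem kingGrad_apply_eq_sum (ν : Fin (d + 1)) (ψ : Tor (fine (L ^ m * L ^ k) M) × Fin (d + 1) → ℝ) (p : Tor (fine (L ^ m * L ^ k) M) × Fin (d + 1)) :
    (symbOp M (L ^ m * L ^ k) (sD M (L ^ m * L ^ k) ν ((L ^ m * L ^ k : ℕ) : ℝ)) ∘ₗ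
        tensorId (Fin (d + 1)) (kingGOp L a msq (k + m) (L ^ m * L ^ k) M)) ψ p
      = ∑ y, (((L ^ m * L ^ k : ℕ) : ℝ) ^ (d + 1))⁻¹ *
          (((L ^ m * L ^ k : ℕ) : ℝ) * (constrainedProp (L ^ m * L ^ k) M (aK a L (k + m)) (((L ^ m * L ^ k : ℕ) : ℝ) ^ 2) msq
              (p.1 + unitVec (fine (L ^ m * L ^ k) M) ν) y
            - constrainedProp (L ^ m * L ^ k) M (aK a L (k + m)) (((L ^ m * L ^ k : ℕ) : ℝ) ^ 2) msq p.1 y)) * ψ (y, p.2) := by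
  rw [LinearMap.comp_apply, symbOp_sD_apply, tensorId_apply, tensorId_apply, kingGOp_apply, kingGOp_apply,
    inv_mulVec_eq_sum, inv_mulVec_eq_sum, ← Finset.sum_sub_distrib, Finset.mul_sum]
  refine Finset.sum_congr rfl fun y _ => ?_
  ring

/-- **… COMPOSED WITH THE SCALED ADJOINT DIFFERENCE** (summation by parts on the torus, `y ↦ y + e_κ`):
`((N′∇′_ν ⊗ 1)(A₀′⁻¹ ⊗ 1)(N′(s_κ⁻¹ − 1))ψ)(x, i) = Σ_y N′^{−(d+1)}·DD_{νκ}G′(x, y)·ψ(y, i)` with the MIXED second difference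
`DD_{νκ}G′(x, y) = N′(N′(G′(x+e_ν, y+e_κ) − G′(x, y+e_κ)) − N′(G′(x+e_ν, y) − G′(x, y)))` of n15-e's part V-a. [cite: King1986, (2.13) p.653, Prop. 3.7 (3.63) p.663] -/
theorem kingGrad_divAdj_apply_eq_sum (ν κ : Fin (d + 1)) (ψ : Tor (fine (L ^ m * L ^ k) M) × Fin (d + 1) → ℝ)
    (p : Tor (fine (L ^ m * L ^ k) M) × Fin (d + 1)) :
    ((symbOp M (L ^ m * L ^ k) (sD M (L ^ m * L ^ k) ν ((L ^ m * L ^ k : ℕ) : ℝ)) ∘ₗ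
        tensorId (Fin (d + 1)) (kingGOp L a msq (k + m) (L ^ m * L ^ k) M)) ∘ₗ
        symbOp M (L ^ m * L ^ k) (((L ^ m * L ^ k : ℕ) : ℝ) • (sTinv M (L ^ m * L ^ k) κ - 1))) ψ p
      = ∑ y, (((L ^ m * L ^ k : ℕ) : ℝ) ^ (d + 1))⁻¹ *
          (((L ^ m * L ^ k : ℕ) : ℝ) * (((L ^ m * L ^ k : ℕ) : ℝ) *
              (constrainedProp (L ^ m * L ^ k) M (aK a L (k + m)) (((L ^ m * L ^ k : ℕ) : ℝ) ^ 2) msq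
                  (p.1 + unitVec (fine (L ^ m * L ^ k) M) ν) (y + unitVec (fine (L ^ m * L ^ k) M) κ)
                - constrainedProp (L ^ m * L ^ k) M (aK a L (k + m)) (((L ^ m * L ^ k : ℕ) : ℝ) ^ 2) msq p.1 (y + unitVec (fine (L ^ m * L ^ k) M) κ))
            - ((L ^ m * L ^ k : ℕ) : ℝ) *
              (constrainedProp (L ^ m * L ^ k) M (aK a L (k + m)) (((L ^ m * L ^ k : ℕ) : ℝ) ^ 2) msq
                  (p.1 + unitVec (fine (L ^ m * L ^ k) M) ν) y
                - constrainedProp (L ^ m * L ^ k) M (aK a L (k + m)) (((L ^ m * L ^ k : ℕ) : ℝ) ^ 2) msq p.1 y))) * ψ (y, p.2) := by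
  rw [LinearMap.comp_apply, kingGrad_apply_eq_sum]
  have hχ : ∀ y : Tor (fine (L ^ m * L ^ k) M), symbOp M (L ^ m * L ^ k) (((L ^ m * L ^ k : ℕ) : ℝ) • (sTinv M (L ^ m * L ^ k) κ - 1)) ψ (y, p.2)
      = ((L ^ m * L ^ k : ℕ) : ℝ) * (ψ (y - unitVec (fine (L ^ m * L ^ k) M) κ, p.2) - ψ (y, p.2)) := by
    intro y
    rw [map_smul, map_sub, map_one, LinearMap.smul_apply, LinearMap.sub_apply, Pi.smul_apply, Pi.sub_apply, smul_eq_mul,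
      symbOp_sTinv_apply]
    rfl
  have key := sum_kernel_mul_adjDiff
    (fun y : Tor (fine (L ^ m * L ^ k) M) => ((L ^ m * L ^ k : ℕ) : ℝ) *
      (constrainedProp (L ^ m * L ^ k) M (aK a L (k + m)) (((L ^ m * L ^ k : ℕ) : ℝ) ^ 2) msq (p.1 + unitVec (fine (L ^ m * L ^ k) M) ν) y
        - constrainedProp (L ^ m * L ^ k) M (aK a L (k + m)) (((L ^ m * L ^ k : ℕ) : ℝ) ^ 2) msq p.1 y))
    (fun y => ψ (y, p.2)) (unitVec (fine (L ^ m * L ^ k) M) κ) ((((L ^ m * L ^ k : ℕ) : ℝ) ^ (d + 1))⁻¹) (((L ^ m * L ^ k : ℕ) : ℝ))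
  beta_reduce at key
  rw [← key]
  exact Finset.sum_congr rfl fun y _ => by rw [hχ]

end Kernel


/-! ## §3 Level arithmetic: the far levels (one factor `e^{−c·L^{i−k}}` per level) and the near levels -/

omit [NeZero L] [∀ μ, NeZero (M μ)] in
/-- **THE FAR LEVEL COUNT**: `Σ_{i<K′} e^{−c·L^i∕L^k} ≤ (k + 1) + (1 − e^{−c})⁻¹` for `c > 0`, `L ≥ 2` — the levels coarser than the cell (`i ≤ k`) cost one each
(the COARSE logarithm `k + 1`), the finer ones a geometric series (`L^{i−k} ≥ i − k`). [folklore] -/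
theorem levelFar_sum_le (hL : 2 ≤ L) {c : ℝ} (hc : 0 < c) (k K' : ℕ) :
    ∑ i ∈ range K', Real.exp (-(c * ((L : ℝ) ^ i / (L : ℝ) ^ k))) ≤ ((k : ℝ) + 1) + (1 - Real.exp (-c))⁻¹ := by
  have hL1 : (1 : ℝ) ≤ L := by exact_mod_cast (show 1 ≤ L by omega)
  have hL0 : (0 : ℝ) < L := by linarith
  have hLk : (0 : ℝ) < (L : ℝ) ^ k := pow_pos hL0 k
  set r : ℝ := Real.exp (-c) with hr
  have hr0 : 0 ≤ r := (Real.exp_pos _).le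
  have hr1 : r < 1 := Real.exp_lt_one_iff.mpr (by linarith)
  -- split the range at `k + 1`
  have hsplit : ∑ i ∈ range K', Real.exp (-(c * ((L : ℝ) ^ i / (L : ℝ) ^ k)))
      ≤ ∑ i ∈ range (k + 1), Real.exp (-(c * ((L : ℝ) ^ i / (L : ℝ) ^ k)))
        + ∑ i ∈ Ico (k + 1) (max K' (k + 1)), Real.exp (-(c * ((L : ℝ) ^ i / (L : ℝ) ^ k))) := by
    rw [Finset.sum_range_add_sum_Ico _ (le_max_right K' (k + 1))]
    exact Finset.sum_le_sum_of_subset_of_nonneg (Finset.range_subset_range.mpr (le_max_left _ _)) fun i _ _ => (Real.exp_pos _).le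
  -- the coarse levels: each term `≤ 1`
  have hcoarse : ∑ i ∈ range (k + 1), Real.exp (-(c * ((L : ℝ) ^ i / (L : ℝ) ^ k))) ≤ (k : ℝ) + 1 := by
    calc ∑ i ∈ range (k + 1), Real.exp (-(c * ((L : ℝ) ^ i / (L : ℝ) ^ k))) ≤ ∑ _i ∈ range (k + 1), (1 : ℝ) :=
          Finset.sum_le_sum fun i _ => Real.exp_le_one_iff.mpr (by
            have : 0 ≤ c * ((L : ℝ) ^ i / (L : ℝ) ^ k) := by positivity
            linarith)
      _ = (k : ℝ) + 1 := by rw [sum_const, card_range]; simp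
  -- the fine levels: `L^i∕L^k = L^{i−k} ≥ i − k`, so the term is `≤ r^{i−k}`
  have hfine : ∑ i ∈ Ico (k + 1) (max K' (k + 1)), Real.exp (-(c * ((L : ℝ) ^ i / (L : ℝ) ^ k))) ≤ (1 - r)⁻¹ := by
    have hterm : ∀ i ∈ Ico (k + 1) (max K' (k + 1)), Real.exp (-(c * ((L : ℝ) ^ i / (L : ℝ) ^ k))) ≤ r ^ (i - k) := by
      intro i hi
      have hik : k + 1 ≤ i := (Finset.mem_Ico.mp hi).1
      have hpow : (L : ℝ) ^ i / (L : ℝ) ^ k = (L : ℝ) ^ (i - k) := by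
        rw [div_eq_iff hLk.ne', ← pow_add, Nat.sub_add_cancel (by omega)]
      have hge : ((i - k : ℕ) : ℝ) ≤ (L : ℝ) ^ (i - k) := by
        have h2 : ((i - k : ℕ) : ℝ) < (2 : ℝ) ^ (i - k) := by exact_mod_cast (i - k).lt_two_pow_self
        have h3 : (2 : ℝ) ^ (i - k) ≤ (L : ℝ) ^ (i - k) := pow_le_pow_left₀ (by norm_num) (by exact_mod_cast hL) _
        linarith
      rw [hpow, hr, ← Real.exp_nat_mul, Real.exp_le_exp]
      nlinarith
    calc ∑ i ∈ Ico (k + 1) (max K' (k + 1)), Real.exp (-(c * ((L : ℝ) ^ i / (L : ℝ) ^ k)))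
        ≤ ∑ i ∈ Ico (k + 1) (max K' (k + 1)), r ^ (i - k) := Finset.sum_le_sum hterm
      _ = ∑ j ∈ range (max K' (k + 1) - (k + 1)), r ^ (j + 1) := by
          rw [Finset.sum_Ico_eq_sum_range]
          exact Finset.sum_congr rfl fun j _ => by rw [show k + 1 + j - k = j + 1 by omega]
      _ = r * ∑ j ∈ range (max K' (k + 1) - (k + 1)), r ^ j := by
          rw [Finset.mul_sum]
          exact Finset.sum_congr rfl fun j _ => by rw [pow_succ]; ring
      _ ≤ r * (1 - r)⁻¹ := by
          refine mul_le_mul_of_nonneg_left ?_ hr0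
          have h := geom_sum_Ico_le_of_lt_one (m := 0) (n := max K' (k + 1) - (k + 1)) hr0 hr1
          rw [← Finset.range_eq_Ico, pow_zero, one_div] at h
          exact h
      _ ≤ (1 - r)⁻¹ := mul_le_of_le_one_left (inv_nonneg.mpr (by linarith)) hr1.le
  linarith

omit [NeZero L] [∀ μ, NeZero (M μ)] in
/-- **THE NEAR COARSE LEVELS**: `Σ_{i ≤ k} q^i ≤ 2q^k` for `q ≥ 2` (`q = L^d`). [folklore] -/
theorem geom_le_two_mul_pow {q : ℝ} (hq : 2 ≤ q) (k : ℕ) : ∑ i ∈ range (k + 1), q ^ i ≤ 2 * q ^ k := by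
  induction k with
  | zero => simp
  | succ k ih =>
      rw [Finset.sum_range_succ]
      have : q ^ k ≤ q ^ (k + 1) / 2 := by
        rw [pow_succ, le_div_iff₀ (by norm_num : (0:ℝ) < 2)]
        nlinarith [pow_nonneg (by linarith : (0:ℝ) ≤ q) k]
      linarith

omit [NeZero L] [∀ μ, NeZero (M μ)] in
/-- **THE NEAR FINE LEVELS**: `Σ_{k < i < K′} L^{−i} ≤ L^{−k}` for `L ≥ 2`. [folklore] -/
theorem fineLevels_sum_le (hL : 2 ≤ L) (k K' : ℕ) :
    ∑ i ∈ (range K').filter (fun i => k < i), ((L : ℝ) ^ i)⁻¹ ≤ ((L : ℝ) ^ k)⁻¹ := by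
  have hL0 : (0 : ℝ) < L := by exact_mod_cast (show 0 < L by omega)
  set r : ℝ := (L : ℝ)⁻¹ with hr
  have hr0 : 0 ≤ r := by positivity
  have hr1 : r < 1 := inv_lt_one_of_one_lt₀ (by exact_mod_cast (show 1 < L by omega))
  have hr12 : r ≤ 1 / 2 := by rw [hr, one_div]; exact inv_anti₀ (by norm_num) (by exact_mod_cast hL)
  have hsub : (range K').filter (fun i => k < i) ⊆ Ico (k + 1) (max K' (k + 1)) := by
    intro i hi
    rw [Finset.mem_filter, Finset.mem_range] at hi
    rw [Finset.mem_Ico]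
    exact ⟨hi.2, lt_max_of_lt_left hi.1⟩
  calc ∑ i ∈ (range K').filter (fun i => k < i), ((L : ℝ) ^ i)⁻¹
      ≤ ∑ i ∈ Ico (k + 1) (max K' (k + 1)), ((L : ℝ) ^ i)⁻¹ :=
        Finset.sum_le_sum_of_subset_of_nonneg hsub fun i _ _ => by positivity
    _ = ∑ i ∈ Ico (k + 1) (max K' (k + 1)), r ^ i := Finset.sum_congr rfl fun i _ => by rw [hr, inv_pow]
    _ ≤ r ^ (k + 1) / (1 - r) := geom_sum_Ico_le_of_lt_one hr0 hr1
    _ ≤ r ^ k := by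
        rw [div_le_iff₀ (by linarith), pow_succ]
        nlinarith [pow_nonneg hr0 k]
    _ = ((L : ℝ) ^ k)⁻¹ := by rw [hr, inv_pow]


/-! ## §6 Cell-constant cut-offs of a line-mean-zero multiplier; the near∕far split -/

section Cutoff

variable {κ : Fin (d + 1)} {S : Tor (fine (L ^ m * L ^ k) M) → Prop} [DecidablePred S]

/-- a cut-off by a CELL-CONSTANT predicate keeps the zero line means (the `κ`-line of a cell stays in the cell, `kingPr_linePt`). [folklore] -/
theorem lineMean_cellCut_eq_zero (hS : ∀ s z, kingPr L k m M s = kingPr L k m M z → (S s ↔ S z))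
    {g gS : Tor (fine (L ^ m * L ^ k) M) × Fin (d + 1) → ℝ} (hgS : ∀ z, gS z = if S z.1 then g z else 0) (hg : lineMean M (L ^ m * L ^ k) (L ^ m) κ g = 0) :
    lineMean M (L ^ m * L ^ k) (L ^ m) κ gS = 0 := by
  funext z
  have hz := congrFun hg z
  rw [lineMean_apply, Pi.zero_apply] at hz ⊢
  have hterm : ∀ j ∈ range (L ^ m), gS (linePt M (L ^ m * L ^ k) (L ^ m) κ z.1 j, z.2)
      = if S z.1 then g (linePt M (L ^ m * L ^ k) (L ^ m) κ z.1 j, z.2) else 0 := by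
    intro j hj
    have hc : S (linePt M (L ^ m * L ^ k) (L ^ m) κ z.1 j) ↔ S z.1 := hS _ _ (kingPr_linePt M L k m κ z.1 (mem_range.mp hj))
    rw [hgS]
    by_cases h : S z.1
    · rw [if_pos h, if_pos (hc.mpr h)]
    · rw [if_neg h, if_neg (mt hc.mp h)]
  rw [Finset.sum_congr rfl hterm]
  by_cases h : S z.1
  · simp only [h, if_true]; exact hz
  · simp only [h, if_false, Finset.sum_const_zero, mul_zero]

/-- … and its line antiderivative vanishes on the cells that are cut away. [folklore] -/
theorem linePrim_cellCut_eq_zero (hS : ∀ s z, kingPr L k m M s = kingPr L k m M z → (S s ↔ S z))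
    {g gS : Tor (fine (L ^ m * L ^ k) M) × Fin (d + 1) → ℝ} (hgS : ∀ z, gS z = if S z.1 then g z else 0) {z : Tor (fine (L ^ m * L ^ k) M) × Fin (d + 1)} (hz : ¬ S z.1) :
    linePrim M (L ^ m * L ^ k) (L ^ m) κ gS z = 0 := by
  have hℓ0 : 0 < L ^ m := pow_pos (Nat.pos_of_ne_zero (NeZero.ne L)) m
  rw [linePrim_apply]
  have hterm : ∀ j ∈ range (cellOff M (L ^ m * L ^ k) (L ^ m) z.1 κ + 1), gS (linePt M (L ^ m * L ^ k) (L ^ m) κ z.1 j, z.2) = 0 := by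
    intro j hj
    have hjlt : j < L ^ m := lt_of_lt_of_le (mem_range.mp hj) (cellOff_lt M (L ^ m * L ^ k) hℓ0 z.1 κ)
    have hc : S (linePt M (L ^ m * L ^ k) (L ^ m) κ z.1 j) ↔ S z.1 := hS _ _ (kingPr_linePt M L k m κ z.1 hjlt)
    rw [hgS, if_neg (mt hc.mp hz)]
  rw [Finset.sum_congr rfl hterm, Finset.sum_const_zero, mul_zero]

omit [NeZero L] [∀ μ, NeZero (M μ)] in
/-- size of a cut-off. [folklore] -/
theorem abs_cellCut_le {g gS : Tor (fine (L ^ m * L ^ k) M) × Fin (d + 1) → ℝ} (hgS : ∀ z, gS z = if S z.1 then g z else 0) {ω : ℝ} (hω : 0 ≤ ω)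
    (hg : ∀ z, |g z| ≤ ω) (z : Tor (fine (L ^ m * L ^ k) M) × Fin (d + 1)) : |gS z| ≤ ω := by
  rw [hgS]
  by_cases h : S z.1
  · rw [if_pos h]; exact hg z
  · rw [if_neg h, abs_zero]; exact hω

end Cutoff

/-- **THE FAR PREDICATE is cell-constant** (`Far x z`: every point of the cell of `z` is at fine distance `≥ L^m` from `x`). [folklore] -/
theorem far_cellConst (x : Tor (fine (L ^ m * L ^ k) M)) (s z : Tor (fine (L ^ m * L ^ k) M)) (h : kingPr L k m M s = kingPr L k m M z) :
    (∀ s' : Tor (fine (L ^ m * L ^ k) M), kingPr L k m M s' = kingPr L k m M s → ((L ^ m : ℕ) : ℝ) ≤ tdistT (fine (L ^ m * L ^ k) M) x s')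
      ↔ (∀ s' : Tor (fine (L ^ m * L ^ k) M), kingPr L k m M s' = kingPr L k m M z → ((L ^ m : ℕ) : ℝ) ≤ tdistT (fine (L ^ m * L ^ k) M) x s') := by
  rw [h]

/-- **NEAR CELLS LIE IN THE BALL OF RADIUS `2L^m`** (cell diameter `≤ L^m − 1` + the witness). [folklore] -/
theorem tdistT_lt_of_not_far {x z : Tor (fine (L ^ m * L ^ k) M)}
    (h : ¬ ∀ s' : Tor (fine (L ^ m * L ^ k) M), kingPr L k m M s' = kingPr L k m M z → ((L ^ m : ℕ) : ℝ) ≤ tdistT (fine (L ^ m * L ^ k) M) x s') :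
    tdistT (fine (L ^ m * L ^ k) M) x z < 2 * ((L ^ m : ℕ) : ℝ) := by
  push Not at h
  obtain ⟨s, hs, hlt⟩ := h
  have hdiam := tdistT_le_of_kingPr_eq L M k m hs
  have htri := tdistT_triangle (fine (L ^ m * L ^ k) M) x s z
  linarith

end Summit.QuantumFields.YangMills.BalabanUVNodes.N15.KingModel.CellOsc
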